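import Mathlib
import Summits.ResolutionOfSingularities.ResolutionOfSingularities.Theorems.RadicialJungCleanModelsCleanProp44NearLineSchemeCorner
import HarnessLib

/-!
# Route `RadicialJung`, crux `CleanModels` (stmt-ResolutionOfSingularities-15917), line `Sketch` rev 35, stub 6 `stub_cleanProp44` (X44c):
# CLEAN-PERMISSIBILITY OF EXCEPTIONAL CURVES — THE SIDE-FAMILY CLASSIFICATION (pure local algebra, centre-free)

Seat decomp-res-hand-2 g19 (structural hand).  Brick (v) of hand-2 g18's census of the Phase II / curve-slice residual of X44c
(`Cruxes/CleanModels/Lines/Sketch-memo-hand2-g18-stubs-5-7.md` §2 (a)/(d)): the local classification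
✓ `cleanPermissibleAt_exceptionalCurve_or_obstruction` («permissible ∨ corner ∨ tangent side ∨ birth», `…CleanProp44NearLineClassification.lean`)
was proved for POINT-LIKE data only (`b = 0`: no clean component transversal to the centre).  Here is the MOST GENERAL LOCAL FORM, from which
every centre (point or curve, any `b`) is a specialisation: a regular local ring `R` of dimension `3` read in a field `F` of characteristic `p`
by an injective `f`, an «exceptional parameter» `e'`, a SIDE FAMILY `s : Fin r → R` with `(e', s₀, …, s_{r-1})` part of a regular system of
parameters, exponents `ex_j` each ZERO OR PRIME TO `p`, a unit `V`, and a non-trivial representative of the line of `G` of the shape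
`f(V · e'^A · ∏_j s_j^{ex_j})` — this is exactly what ✓ `exists_transform_normalForm_of_isBlowup` delivers at a point `x'` of the blowing up of a
clean-permissible centre, the sides being the charged fractions `uf_k` (exponents `a_k`) AND the transversal clean components `τ^♯ w_m`
(exponents `b_m`).  For a regular curve germ `N = (e', z)` through the point (`(e', z, z') = 𝔪`):

* `cleanPermissibleAt_or_obstruction_of_sideFamily` — the line is CLEAN-PERMISSIBLE for `N`; or CORNER: two sides `j₁ ≠ j₂` with non-zero
  exponents, `(e', s_{j₁}, s_{j₂}) = 𝔪`, neither in `N`; or TANGENT: a side with non-zero exponent in `(N + 𝔪²) ∖ N`; or BIRTH: every exponent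
  in sight is `0`, `p ∣ A`, and `V` fails the three-way non-birth test of ✓ `cleanPermissibleAt_of_unit_rep`.
* plumbing: `isRsopPart_pair_of_cons`, `isRsopPart_triple_of_cons` (sub-families of `Fin.cons e' s`), `le_two_of_isRsopPart_cons` (at most two
  sides in dimension `3`), `span_pair_eq_of_sideMem` (a side lying in `N` IS the second generator of `N`), `span_triple_eq_maximalIdeal_of_isRsopPart`.

Honest framing: OURS, bookkeeping over the landed local dictionary (✓ `…CleanProp44NearLineLocal.lean`); a TOOL for the (R1ᵐⁱⁿ)/(R3ᵐⁱⁿ′) provers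
(the `l = 1` successor-curve analysis, memo 4e (B3)/(B4)).  Nothing here proves X44c, any case of `CleanModels`, or resolution of singularities in
characteristic `p`.  Setting only: [cite: Piltant2013, §2 Axiom 4] [cite: CossartPiltant2008, Lemma 4.3 (5)] [cite: Matsumura1987, Thm. 14.2].
-/

noncomputable section

set_option linter.dupNamespace false -- mandated namespace of this single-conjunct summit

open IsLocalRing
open Literature.AlgebraicGeometry.Resolution

namespace Summit.ResolutionOfSingularities.ResolutionOfSingularities.Theorems.RadicialJung.CleanModels

universe u

/-! ## §0 Sub-families of a side family -/

section Plumbing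

variable {R : Type u} [CommRing R] [IsLocalRing R]

/-- The pair `(e', s_j)` extracted from a side family `(e', s)` is part of a regular system of parameters. [cite: Matsumura1987, Thm. 14.2] -/
theorem isRsopPart_pair_of_cons {r : ℕ} {e' : R} {s : Fin r → R} (h : IsRsopPart (Fin.cons e' s : Fin (r + 1) → R)) (j : Fin r) :
    IsRsopPart (Fin.append ![e'] ![s j]) := by
  have hinj : Function.Injective (![0, j.succ] : Fin 2 → Fin (r + 1)) := by
    intro t₁ t₂ ht
    fin_cases t₁ <;> fin_cases t₂
    · rfl
    · exfalso
      simp only [Fin.zero_eta, Fin.mk_one, Matrix.cons_val_zero, Matrix.cons_val_one] at ht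
      exact Fin.succ_ne_zero _ ht.symm
    · exfalso
      simp only [Fin.zero_eta, Fin.mk_one, Matrix.cons_val_zero, Matrix.cons_val_one] at ht
      exact Fin.succ_ne_zero _ ht
    · rfl
  have h1 := h.comp _ hinj
  have h2 : (Fin.cons e' s : Fin (r + 1) → R) ∘ (![0, j.succ] : Fin 2 → Fin (r + 1)) = Fin.append ![e'] ![s j] := by
    funext t
    fin_cases t
    · rfl
    · simp only [Function.comp_apply, Fin.mk_one, Matrix.cons_val_one, Matrix.cons_val_fin_one, Fin.cons_succ]
      rfl
  rwa [h2] at h1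

/-- The triple `(e', s_{j₁}, s_{j₂})` (`j₁ ≠ j₂`) extracted from a side family `(e', s)` is part of a regular system of parameters.
[cite: Matsumura1987, Thm. 14.2] -/
theorem isRsopPart_triple_of_cons {r : ℕ} {e' : R} {s : Fin r → R} (h : IsRsopPart (Fin.cons e' s : Fin (r + 1) → R)) {j₁ j₂ : Fin r}
    (hj : j₁ ≠ j₂) : IsRsopPart ![e', s j₁, s j₂] := by
  have hinj : Function.Injective (![0, j₁.succ, j₂.succ] : Fin 3 → Fin (r + 1)) := by
    have hne : j₁.succ ≠ j₂.succ := fun h' => hj (Fin.succ_injective _ h')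
    intro t₁ t₂ ht
    fin_cases t₁ <;> fin_cases t₂
    all_goals (first | rfl | (exfalso; simp only [Fin.zero_eta, Fin.mk_one, Fin.reduceFinMk, Matrix.cons_val_zero, Matrix.cons_val_one,
      Matrix.cons_val_two, Matrix.tail_cons, Matrix.head_cons] at ht; first
        | exact Fin.succ_ne_zero _ ht | exact Fin.succ_ne_zero _ ht.symm | exact hne ht | exact hne ht.symm))
  have h1 := h.comp _ hinj
  have h2 : (Fin.cons e' s : Fin (r + 1) → R) ∘ (![0, j₁.succ, j₂.succ] : Fin 3 → Fin (r + 1)) = ![e', s j₁, s j₂] := by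
    funext t
    fin_cases t
    · rfl
    · simp only [Function.comp_apply, Fin.mk_one, Matrix.cons_val_one, Matrix.cons_val_zero, Fin.cons_succ]
    · simp only [Function.comp_apply, Fin.reduceFinMk, Matrix.cons_val, Fin.cons_succ]
  rwa [h2] at h1

/-- **At most two sides in dimension three**: a side family `(e', s₀, …, s_{r-1})` of a `3`-dimensional regular local ring has `r ≤ 2`.
[cite: Matsumura1987, Thm. 14.2] -/
theorem le_two_of_isRsopPart_cons {r : ℕ} {e' : R} {s : Fin r → R} (h : IsRsopPart (Fin.cons e' s : Fin (r + 1) → R))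
    (hdim : ringKrullDim R = 3) : r ≤ 2 := by
  have h1 := h.natCast_le_ringKrullDim_of_isRsopPart
  rw [hdim] at h1
  have h2 : r + 1 ≤ 3 := by exact_mod_cast h1
  omega

/-- With at most two indices, every index is one of two given distinct ones. [folklore] -/
theorem fin_eq_or_eq_of_le_two {r : ℕ} (hr : r ≤ 2) {j₀ j₁ : Fin r} (hj : j₀ ≠ j₁) (j : Fin r) : j = j₀ ∨ j = j₁ := by
  by_contra hcon
  push Not at hcon
  have h3 : ({j, j₀, j₁} : Finset (Fin r)).card = 3 := by
    rw [Finset.card_insert_of_notMem (by simp [hcon.1, hcon.2]), Finset.card_insert_of_notMem (by simpa using hj),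
      Finset.card_singleton]
  have h4 := Finset.card_le_univ ({j, j₀, j₁} : Finset (Fin r))
  rw [h3, Fintype.card_fin] at h4
  omega

/-- A triple which is part of a regular system of parameters of a `3`-dimensional ring generates `𝔪`. [cite: Matsumura1987, Thm. 14.2] -/
theorem span_triple_eq_maximalIdeal_of_isRsopPart {a b c : R} (h : IsRsopPart ![a, b, c]) (hdim : ringKrullDim R = 3) :
    Ideal.span ({a, b, c} : Set R) = maximalIdeal R := by
  have hr : Set.range ![a, b, c] = {a, b, c} := by
    ext t
    simp only [Set.mem_range, Set.mem_insert_iff, Set.mem_singleton_iff]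
    constructor
    · rintro ⟨j, rfl⟩
      fin_cases j <;> simp
    · rintro (rfl | rfl | rfl)
      exacts [⟨0, rfl⟩, ⟨1, rfl⟩, ⟨2, rfl⟩]
  rw [← hr]
  exact IsRsopPart.span_range_eq_maximalIdeal_of_ringKrullDim_eq h (by rw [hdim]; norm_cast)

/-- **A side lying in the curve is its second generator.**  If `(e', s)` is part of a regular system of parameters, `(e', z, z') = 𝔪` and
`s ∈ N = (e', z)`, then `s = α e' + β z` with `β` a unit, so `N = (e', s)` and `(e', s, z') = 𝔪`. [cite: Matsumura1987, Thm. 14.2] -/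
theorem span_pair_eq_of_sideMem {e' z z' s : R} (hpair : IsRsopPart (Fin.append ![e'] ![s]))
    (hzz : Ideal.span ({e', z, z'} : Set R) = maximalIdeal R) (hsN : s ∈ Ideal.span ({e', z} : Set R)) :
    Ideal.span ({e', s} : Set R) = Ideal.span {e', z} ∧ Ideal.span ({e', s, z'} : Set R) = maximalIdeal R := by
  have hzm : z ∈ maximalIdeal R := hzz ▸ Ideal.subset_span (by simp)
  obtain ⟨α, β, hαβ⟩ := Ideal.mem_span_pair.mp hsN
  have hβ : IsUnit β := by
    by_contra hβ
    apply append_right_not_mem_span_sup_sq hpair 0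
    have hr : Set.range ![e'] = {e'} := by
      ext t; simp
    simp only [Matrix.cons_val_fin_one, hr]
    rw [← hαβ]
    refine Ideal.add_mem _ (Ideal.mem_sup_left (Ideal.mul_mem_left _ _ (Ideal.mem_span_singleton_self _))) (Ideal.mem_sup_right ?_)
    rw [pow_two]
    exact Ideal.mul_mem_mul ((mem_maximalIdeal _).mpr hβ) hzm
  have hs' : s = β * z + α * e' := by rw [← hαβ, add_comm]
  refine ⟨by rw [Ideal.span_pair_comm, nearLine_span_pair_eq_of_isUnit hβ hs', Ideal.span_pair_comm], ?_⟩
  have hswap : ∀ x y t : R, ({x, y, t} : Set R) = {y, x, t} := fun x y t => Set.insert_comm x y {t}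
  rw [hswap, nearLine_span_triple_eq_of_isUnit hβ hs', hswap, hzz]

end Plumbing

/-! ## §1 The side-family classification -/

set_option maxHeartbeats 400000 in
-- one case analysis over the number of sides carrying an exponent
/-- **THE SIDE-FAMILY CLASSIFICATION: clean-permissible, or corner, or tangent side, or birth.**  `R` regular local of dimension `3` read in the
field `F` of characteristic `p` by the injective `f`; `(e', z, z') = 𝔪` and `N = (e', z)`; a side family `s : Fin r → R` with `(e', s)` part of a
regular system of parameters; exponents `ex_j`, each `0` or prime to `p`; a unit `V`; and a non-trivial representative
`Σ_j c_j^p G^j = f(V · e'^A · ∏_j s_j^{ex_j})`.  Then the line of `G` is CLEAN-PERMISSIBLE at `R` for `N`; or (CORNER) two sides `j₁ ≠ j₂` carry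
non-zero exponents, `(e', s_{j₁}, s_{j₂}) = 𝔪`, and neither lies in `N`; or (TANGENT) some side with non-zero exponent lies in `(N + 𝔪²) ∖ N`; or
(BIRTH) all exponents vanish, `p ∣ A`, and `V` fails the non-birth test (`V̄ ∉ κ^p`, or some `V - c'^p ∈ 𝔪 ∖ (N + 𝔪²)`, or some
`V - c'^p ∈ N ∖ 𝔪²`).  The three obstructions are genuine (✓ `not_cleanPermissibleAt_diagonal_cornerWitness`, ✓ `not_cleanPermissibleAt_contactOrder`,
✓ `not_cleanPermissibleAt_of_derivations`). [cite: Piltant2013, §2 Axiom 4] [cite: CossartPiltant2008, Lemma 4.3 (5)] -/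
theorem cleanPermissibleAt_or_obstruction_of_sideFamily {R : Type u} {F : Type u} [CommRing R] [IsLocalRing R] [Field F] {p : ℕ}
    [Fact p.Prime] [CharP F p] (f : R →+* F) (hf : Function.Injective f) (hdim : ringKrullDim R = 3) {e' z z' : R}
    (hzz : Ideal.span ({e', z, z'} : Set R) = maximalIdeal R) {r : ℕ} {s : Fin r → R}
    (hrsop : IsRsopPart (Fin.cons e' s : Fin (r + 1) → R)) {G : F} (cc : Fin p → F) (hcc : ∃ j : Fin p, (j : ℕ) ≠ 0 ∧ cc j ≠ 0)
    {V : R} (hV : IsUnit V) (A : ℕ) {ex : Fin r → ℕ} (hall : ∀ j, ex j = 0 ∨ ¬ p ∣ ex j)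
    (hrep : (∑ j : Fin p, cc j ^ p * G ^ (j : ℕ)) = f (V * e' ^ A * ∏ j, s j ^ ex j)) :
    CleanPermissibleAt p f G (Ideal.span ({e', z} : Set R)) ∨
    (∃ j₁ j₂ : Fin r, j₁ ≠ j₂ ∧ ex j₁ ≠ 0 ∧ ex j₂ ≠ 0 ∧ Ideal.span ({e', s j₁, s j₂} : Set R) = maximalIdeal R ∧
        s j₁ ∉ Ideal.span ({e', z} : Set R) ∧ s j₂ ∉ Ideal.span ({e', z} : Set R)) ∨
    (∃ j : Fin r, ex j ≠ 0 ∧ s j ∉ Ideal.span ({e', z} : Set R) ∧ s j ∈ Ideal.span ({e', z} : Set R) ⊔ maximalIdeal R ^ 2) ∨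
    (p ∣ A ∧ (∀ j, ex j = 0) ∧
      ¬ ((∀ c' : R, V - c' ^ p ∉ maximalIdeal R) ∨
          (∃ c' : R, V - c' ^ p ∈ maximalIdeal R ∧ V - c' ^ p ∉ Ideal.span ({e', z} : Set R) ⊔ maximalIdeal R ^ 2) ∨
          (∃ c' : R, V - c' ^ p ∈ Ideal.span ({e', z} : Set R) ∧ V - c' ^ p ∉ maximalIdeal R ^ 2))) := by
  classical
  have hR : IsRegularLocalRing R := hrsop.isRegularLocalRing
  haveI := isDomain_of_isRegularLocalRing R
  have he'0 : e' ≠ 0 := by simpa using hrsop.ne_zero 0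
  have hsm : ∀ j, s j ∈ maximalIdeal R := fun j => by simpa using hrsop.mem_maximalIdeal j.succ
  have hr2 : r ≤ 2 := le_two_of_isRsopPart_cons hrsop hdim
  by_cases h0 : ∀ j, ex j = 0
  · -- NO side carries an exponent: the representative is `V · e'^A`
    have hprod : ∏ j, s j ^ ex j = 1 := Finset.prod_eq_one fun j _ => by rw [h0 j, pow_zero]
    rw [hprod, mul_one] at hrep
    by_cases hA : p ∣ A
    · by_cases hnb : (∀ c' : R, V - c' ^ p ∉ maximalIdeal R) ∨
          (∃ c' : R, V - c' ^ p ∈ maximalIdeal R ∧ V - c' ^ p ∉ Ideal.span ({e', z} : Set R) ⊔ maximalIdeal R ^ 2) ∨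
          (∃ c' : R, V - c' ^ p ∈ Ideal.span ({e', z} : Set R) ∧ V - c' ^ p ∉ maximalIdeal R ^ 2)
      · left
        have hrepU := rep_eq_mul_pow_of_dvd f cc hA hrep
        have hd : f e' ^ (A / p) ≠ 0 := pow_ne_zero _ ((map_ne_zero_iff f hf).mpr he'0)
        exact cleanPermissibleAt_of_unit_rep f hR hdim hzz cc hcc hV hd hrepU hnb
      · right; right; right
        exact ⟨hA, h0, hnb⟩
    · left
      exact cleanPermissibleAt_exceptional_of_not_dvd f hR hdim hzz cc hcc hV hA hrep
  · -- at least one side carries an exponent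
    push Not at h0
    obtain ⟨j₀, hj₀⟩ := h0
    have hexp₀ : ¬ p ∣ ex j₀ := (hall _).resolve_left hj₀
    by_cases h1 : ∀ j, j ≠ j₀ → ex j = 0
    · -- EXACTLY one side carries an exponent: the representative is `V · e'^A · s_{j₀}^{ex_{j₀}}`
      have hprod : ∏ j, s j ^ ex j = s j₀ ^ ex j₀ :=
        Finset.prod_eq_single j₀ (fun j _ hj => by rw [h1 j hj, pow_zero]) (fun h => absurd (Finset.mem_univ _) h)
      rw [hprod] at hrep
      rcases side_trichotomy hzz (hsm j₀) with htr | hmem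
      · left
        exact cleanPermissibleAt_exceptional_of_side_transversal f hR hdim htr cc hcc hV (Or.inr hexp₀) hrep
      · by_cases hN : s j₀ ∈ Ideal.span ({e', z} : Set R)
        · left
          obtain ⟨hNeq, h𝔪⟩ := span_pair_eq_of_sideMem (isRsopPart_pair_of_cons hrsop j₀) hzz hN
          rw [← hNeq]
          exact cleanPermissibleAt_exceptional_of_side_mem f hR hdim h𝔪 cc hcc hV (Or.inr hexp₀) hrep
        · right; right; left
          exact ⟨j₀, hj₀, hN, hmem⟩
    · -- TWO sides carry exponents (and there is no third side in dimension `3`)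
      push Not at h1
      obtain ⟨j₁, hj₁₀, hj₁⟩ := h1
      have hexp₁ : ¬ p ∣ ex j₁ := (hall _).resolve_left hj₁
      have hj01 : ∀ j, j = j₀ ∨ j = j₁ := fin_eq_or_eq_of_le_two hr2 (Ne.symm hj₁₀)
      have hprod : ∏ j, s j ^ ex j = s j₀ ^ ex j₀ * s j₁ ^ ex j₁ :=
        Finset.prod_eq_mul j₀ j₁ (Ne.symm hj₁₀) (fun j _ h => by rcases hj01 j with h' | h' <;> [exact absurd h' h.1; exact absurd h' h.2])
          (fun h => absurd (Finset.mem_univ _) h) (fun h => absurd (Finset.mem_univ _) h)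
      have htriple : IsRsopPart ![e', s j₀, s j₁] := isRsopPart_triple_of_cons hrsop (Ne.symm hj₁₀)
      have h𝔪 : Ideal.span ({e', s j₀, s j₁} : Set R) = maximalIdeal R := span_triple_eq_maximalIdeal_of_isRsopPart htriple hdim
      by_cases hN₀ : s j₀ ∈ Ideal.span ({e', z} : Set R)
      · left
        obtain ⟨hNeq, -⟩ := span_pair_eq_of_sideMem (isRsopPart_pair_of_cons hrsop j₀) hzz hN₀
        rw [← hNeq]
        rw [hprod, ← mul_assoc] at hrep
        exact cleanPermissibleAt_exceptional_of_two_sides f hR hdim h𝔪 cc hcc hV (Or.inr (Or.inl hexp₀)) hrep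
      · by_cases hN₁ : s j₁ ∈ Ideal.span ({e', z} : Set R)
        · left
          obtain ⟨hNeq, -⟩ := span_pair_eq_of_sideMem (isRsopPart_pair_of_cons hrsop j₁) hzz hN₁
          rw [← hNeq]
          have h𝔪' : Ideal.span ({e', s j₁, s j₀} : Set R) = maximalIdeal R := by
            rw [← h𝔪]
            congr 1
            ext t
            simp only [Set.mem_insert_iff, Set.mem_singleton_iff]
            tauto
          rw [hprod, mul_comm (s j₀ ^ ex j₀), ← mul_assoc] at hrep
          exact cleanPermissibleAt_exceptional_of_two_sides f hR hdim h𝔪' cc hcc hV (Or.inr (Or.inl hexp₁)) hrep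
        · right; left
          exact ⟨j₀, j₁, Ne.symm hj₁₀, hj₀, hj₁, h𝔪, hN₀, hN₁⟩

end Summit.ResolutionOfSingularities.ResolutionOfSingularities.Theorems.RadicialJung.CleanModels

end
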